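import Summits.BirchSwinnertonDyer.Rank1Residual.GaloisImage.PrimeChoiceSelection
import Summits.BirchSwinnertonDyer.Rank1Residual.GaloisImage.PrimeChoiceCoveringIndependent
import HarnessLib

/-!
# The prime-choice selection for an INDEPENDENT family plus one class (Sakamoto's Lemma 5.2,
# group-theoretic half) — `γ ∈ Gal(K̄/K(T̄, μ_N))` with every `cᵢ(τγ), c′(τγ) ∉ (τ − 1)T̄`
# (cell `b2b-bsdres`, team n1011, row T-C55K-4 = appendix of T-C55K for route planner 1's R1-56
# "S24(1)@m=1 in the kernel", the K2/K3 input of [S24] Lemma 6.4; file B — COCYCLE ALGEBRA; seat p15)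

HONEST FRAMING (cell `b2b-bsdres`, run/shared/lean/b2b/bsd-rank1-residual/, verbatim in every
file): the goal of the cell is to DELETE the COMBINATION-SHAPED residual classes of the
Birch–Swinnerton-Dyer formula for ALL analytic-rank `≤ 1` elliptic curves over `ℚ` — "full BSD
formula for every rank `≤ 1` curve in class `C`" assembled STRICTLY from published theorems — so
that the rank-`≤ 1` remainder becomes exactly the CONSTRUCTION-SHAPED classes, which are TYPED
(missing-input `Prop`s), NOT attempted. This is not "finishing BSD". Team n1011 (N10/N11, the
additive block `X4 ∧ p = 3`): research route; TOOL theorems of group cohomology (no class theorem,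
nothing booked, no mark changed); no definition, no named fact, no `sorry`.

## What and why

T-C55K's file 2 (`PrimeChoiceSelection.lean`, p269759) selects, for `n ≤ p` crossed homomorphisms
with non-zero classes, a `γ ∈ G_F = ker ρ ⊓ Gal(K̄/K(μ_N))` with `cᵢ(τγ) ∉ (τ − 1)T̄` — the
group-theoretic half of [S24] Cor. 5.5.  [S24] Lemma 6.4 (connectedness of the core graph `𝒳⁰`,
R1-56 K3) needs instead LEMMA 5.2: FOUR classes whose span has dimension `≥ 3` (Remark 5.3: three
ARBITRARY classes plus a fourth do not suffice at `p = 3`).  This file is the selection for the form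
Lemma 6.4 uses — an `𝔽_p`-LINEARLY-INDEPENDENT family of classes plus ONE more non-zero class —
assembled from file A (`PrimeChoiceCoveringIndependent.lean`: joint surjectivity of independent
homomorphisms `G_F → 𝔽_p` and the one-affine-condition avoidance) and T-C55K's KEY LEMMA
`oneCocycleClass_eq_zero_of_forall_apply_mem_range` (values on `G_F` inside `(τ − 1)T̄` force a
principal cocycle, from (H.1) + (H.3)):

* `exists_forall_apply_mul_notMem_range_of_restrictions` — for cocycles `cᵢ` whose restrictions to
  `G_F` read modulo `(τ − 1)T̄` are `𝔽_p`-independent FUNCTIONS, `∃ γ ∈ G_F, ∀ i, cᵢ(τγ) ∉ (τ − 1)T̄`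
  (no (H.1)/(H.3) needed; any `p`);
* `exists_forall_apply_mul_notMem_range_of_restrictions_extra` — the same PLUS one cocycle `c′`
  whose restriction is the combination `Σ bᵢ c̄ᵢ`, `b ≠ 0` (`p ≥ 3`; the value `c′(τ)` is then
  forced to be `Σ bᵢ cᵢ(τ)` modulo `(τ − 1)T̄` by the key lemma);
* `exists_forall_apply_mul_notMem_range_of_linearIndependent` — **Sakamoto's Lemma 5.2, selection
  half**: classes `[cᵢ]` `𝔽_p`-linearly independent in `H¹(K, T̄)` and `[c′] ≠ 0`, (H.1), (H.3),
  `T̄/(τ − 1)T̄ ≃ ℤ/p`, `p ≥ 3` ⟹ `∃ γ ∈ G_F` with every `cᵢ(τγ) ∉ (τ − 1)T̄` and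
  `c′(τγ) ∉ (τ − 1)T̄` (independence of classes ⟹ independence of restrictions by the key lemma;
  then the dichotomy "`c̄′ ∈ span c̄ᵢ`" / "not": the first case is `…_extra`, the second is
  `…_of_restrictions` for the family on `Option ι`).

References: R. Sakamoto, JTNB **36** (2024), Lemma 5.1, Lemma 5.2 and its proof (pp. 927–929),
Lemma 6.4 (pp. 931–932) [Sakamoto2024]; B. Mazur, K. Rubin, Mem. AMS **799** (2004), Prop. 3.6.1
proof (p. 31) [MazurRubin2004].
-/

noncomputable section

open Function
open Literature.NumberTheory.GaloisRepresentations Literature.NumberTheory.GaloisCohomology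

universe u

namespace Summit.BirchSwinnertonDyer.Rank1Residual.GaloisImage.PrimeChoice

variable {K : Type u} [Field K] {M : Type u} [AddCommGroup M] [TopologicalSpace M]
  [DiscreteTopology M] {ρ : DiscreteGaloisModule K M}

/-! ## Integral combinations of crossed homomorphisms -/

/-- Evaluating an integral combination `Σ ãⱼ dⱼ` of crossed homomorphisms and reading the value
through an additive map to `𝔽_p` gives `Σ aⱼ · (value of dⱼ)` (`ãⱼ = val aⱼ`). [folklore] -/
theorem map_sum_val_nsmul_apply {p : ℕ} [NeZero p] (π : M →+ ZMod p) {κ : Type*} [Fintype κ]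
    (d : κ → contOneCocycles ρ.toTopRep) (a : κ → ZMod p) (g : Field.absoluteGaloisGroup K) :
    π ((∑ j, (a j).val • d j : contOneCocycles ρ.toTopRep).1 g) = ∑ j, a j * π ((d j).1 g) := by
  let ev : contOneCocycles ρ.toTopRep →+ M :=
    { toFun := fun ψ => ψ.1 g, map_zero' := rfl, map_add' := fun _ _ => rfl }
  have h1 : (∑ j, (a j).val • d j : contOneCocycles ρ.toTopRep).1 g =
      ∑ j, (a j).val • (d j).1 g := by
    change ev (∑ j, (a j).val • d j) = ∑ j, (a j).val • ev (d j)
    rw [map_sum]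
    exact Finset.sum_congr rfl fun j _ => map_nsmul ev _ _
  rw [h1, map_sum]
  refine Finset.sum_congr rfl fun j _ => ?_
  rw [map_nsmul, nsmul_eq_mul, ZMod.natCast_zmod_val]

/-- The class of an integral combination of crossed homomorphisms is the combination of the
classes (`oneCocycleClassₗ` is linear). [folklore] -/
theorem oneCocycleClass_sum_nsmul {κ : Type*} [Fintype κ] (d : κ → contOneCocycles ρ.toTopRep)
    (n : κ → ℕ) :
    oneCocycleClass ρ.toTopRep (∑ j, n j • d j) = ∑ j, n j • oneCocycleClass ρ.toTopRep (d j) := by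
  rw [← oneCocycleClassₗ_apply, map_sum]
  exact Finset.sum_congr rfl fun j _ => by rw [map_nsmul, oneCocycleClassₗ_apply]

/-! ## Selection for cocycles with independent restrictions to `G_F` -/

/-- **Selection, independent restrictions, plus one dependent cocycle** (`p ≥ 3`).  Let
`cᵢ : Γ_K → T̄` (`i ∈ ι`) be continuous crossed homomorphisms whose restrictions to
`G_F = ker ρ ⊓ Gal(K̄/K(μ_N))`, read in `T̄/(τ − 1)T̄ ≃ ℤ/p` through `e`, are `𝔽_p`-linearly
independent as functions (`hres`), and `c′` one more cocycle whose restriction is the combination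
`Σ bᵢ c̄ᵢ` with `b ≠ 0` (`hdep`).  Under (H.1) and (H.3) (tree shapes, for the key lemma, which
forces `c′(τ) ≡ Σ bᵢ cᵢ(τ)`): `∃ γ ∈ G_F` with `cᵢ(τγ) ∉ (τ − 1)T̄` for all `i` and
`c′(τγ) ∉ (τ − 1)T̄`.  (Sakamoto's Lemma 5.1, "dimension 3" case, fed with the crossed
homomorphisms.) [cite: Sakamoto2024, Lemma 5.1 and Lemma 5.2 (pp. 927–929)]
[cite: MazurRubin2004, Prop. 3.6.1 proof, p. 31] -/
theorem exists_forall_apply_mul_notMem_range_of_restrictions_extra {p : ℕ} [Fact p.Prime]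
    (hp : 3 ≤ p) {N : ℕ} {τ : Field.absoluteGaloisGroup K} (e : cokerSubOne ρ τ ≃+ ZMod p)
    (hirr : ∀ A : AddSubgroup M,
      (∀ (s : Field.absoluteGaloisGroup K), ∀ m ∈ A, ρ s m ∈ A) → A = ⊥ ∨ A = ⊤)
    (hH3 : ∀ f : contOneCocycles ρ.toTopRep,
      (∀ u : Field.absoluteGaloisGroup K, ρ u = 1 → u ∈ rootsOfUnityFixer K N → f.1 u = 0) →
        oneCocycleClass ρ.toTopRep f = 0)
    {ι : Type*} [Fintype ι] [DecidableEq ι] (c : ι → contOneCocycles ρ.toTopRep)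
    (hres : ∀ a : ι → ZMod p,
      (∀ g : Field.absoluteGaloisGroup K, ρ g = 1 → g ∈ rootsOfUnityFixer K N →
        ∑ i, a i * e (QuotientAddGroup.mk ((c i).1 g)) = 0) → a = 0)
    (c' : contOneCocycles ρ.toTopRep) {b : ι → ZMod p} (hb : b ≠ 0)
    (hdep : ∀ g : Field.absoluteGaloisGroup K, ρ g = 1 → g ∈ rootsOfUnityFixer K N →
      (e (QuotientAddGroup.mk (c'.1 g)) : ZMod p) = ∑ i, b i * e (QuotientAddGroup.mk ((c i).1 g))) :
    ∃ γ : Field.absoluteGaloisGroup K, ρ γ = 1 ∧ γ ∈ rootsOfUnityFixer K N ∧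
      (∀ i, (c i).1 (τ * γ) ∉ ((ρ τ).toAddMonoidHom - AddMonoidHom.id M).range) ∧
      c'.1 (τ * γ) ∉ ((ρ τ).toAddMonoidHom - AddMonoidHom.id M).range := by
  classical
  -- the group `G_F = ker ρ ⊓ Gal(K̄/K(μ_N))` as a subgroup
  set GF : Subgroup (Field.absoluteGaloisGroup K) := ρ.ker ⊓ rootsOfUnityFixer K N with hGF_def
  have hmemGF : ∀ g : Field.absoluteGaloisGroup K, g ∈ GF ↔ ρ g = 1 ∧ g ∈ rootsOfUnityFixer K N :=
    fun g => by rw [hGF_def, Subgroup.mem_inf, ContinuousRep.mem_ker]; exact Iff.rfl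
  set R : AddSubgroup M := ((ρ τ).toAddMonoidHom - AddMonoidHom.id M).range with hR_def
  -- `π = e ∘ (mod (τ − 1)T̄) : T̄ → 𝔽_p`
  let π : M →+ ZMod p := e.toAddMonoidHom.comp (QuotientAddGroup.mk' R)
  have hπ : ∀ m, π m = e (QuotientAddGroup.mk m) := fun m => rfl
  have hπ0 : ∀ m, π m = 0 ↔ m ∈ R := fun m => by
    rw [hπ, e.map_eq_zero_iff, QuotientAddGroup.eq_zero_iff]
  -- the data of file A
  let E : ι → (↥GF → ZMod p) := fun i g => π ((c i).1 g)
  let F : (ι → ZMod p) →ₗ[ZMod p] (↥GF → ZMod p) := Fintype.linearCombination (ZMod p) E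
  have hFapply : ∀ a (g : GF), F a g = ∑ i, a i * π ((c i).1 g) := fun a g => by
    change (Fintype.linearCombination (ZMod p) E a) g = _
    rw [Fintype.linearCombination_apply, Finset.sum_apply]
    simp only [Pi.smul_apply, smul_eq_mul, E]
  have hFsingle : ∀ i (g : GF), F (Pi.single i 1) g = π ((c i).1 g) := fun i g => by
    change (Fintype.linearCombination (ZMod p) E (Pi.single i 1)) g = _
    rw [Fintype.linearCombination_apply_single, one_smul]
  have hFmul : ∀ a (g h : GF), F a (g * h) = F a g + F a h := by
    intro a g h
    rw [hFapply, hFapply, hFapply, ← Finset.sum_add_distrib]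
    refine Finset.sum_congr rfl fun i _ => ?_
    rw [Subgroup.coe_mul, apply_mul_of_apply_eq_one (c i) ((hmemGF g).mp g.2).1, map_add, mul_add]
  have hker : ∀ a, F a = 0 → a = 0 := fun a ha =>
    hres a fun g hg hgμ => by
      have h := congrFun ha ⟨g, (hmemGF g).mpr ⟨hg, hgμ⟩⟩
      rw [hFapply] at h
      exact h
  -- the value of `c′` at `τ` is forced: `c′(τ) ≡ Σ bᵢ cᵢ(τ)` (key lemma applied to `c′ − Σ b̃ᵢ cᵢ`)
  haveI : NeZero p := ⟨(Fact.out : p.Prime).ne_zero⟩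
  have hcomb : ∀ (a : ι → ZMod p) (g : Field.absoluteGaloisGroup K),
      π ((∑ i, (a i).val • c i : contOneCocycles ρ.toTopRep).1 g) = ∑ i, a i * π ((c i).1 g) :=
    fun a g => map_sum_val_nsmul_apply π c a g
  have hτval : π (c'.1 τ) = ∑ i, b i * π ((c i).1 τ) := by
    set ψ : contOneCocycles ρ.toTopRep := c' - ∑ i, (b i).val • c i with hψ_def
    have hψapply : ∀ g, ψ.1 g = c'.1 g - (∑ i, (b i).val • c i : contOneCocycles ρ.toTopRep).1 g :=
      fun g => rfl
    have hψ : oneCocycleClass ρ.toTopRep ψ = 0 := by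
      refine oneCocycleClass_eq_zero_of_forall_apply_mem_range e hirr hH3 ψ fun g hg hgμ => ?_
      rw [← hπ0, hψapply, map_sub, hcomb, hπ, hdep g hg hgμ]
      exact sub_self _
    obtain ⟨v, hv⟩ := (oneCocycleClass_eq_zero_iff _ ψ).mp hψ
    have hτR : ψ.1 τ ∈ R := by rw [hv τ]; exact ⟨v, rfl⟩
    rw [← hπ0, hψapply, map_sub, hcomb, sub_eq_zero] at hτR
    exact hτR
  -- file A, dependent case
  obtain ⟨g, hg, hg'⟩ := exists_forall_apply_add_ne_zero_and_sum_of_ker_eq_bot hp F hFmul hker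
    (fun i => π ((c i).1 τ)) hb (π (c'.1 τ))
  refine ⟨g, ((hmemGF g).mp g.2).1, ((hmemGF g).mp g.2).2, fun i hi => ?_, fun h' => ?_⟩
  · apply hg i
    rw [hFsingle, add_comm, hπ, hπ, ← map_add, ← mk_apply_mul_eq τ _ (c i), ← hπ, hπ0]
    exact hi
  · apply hg'
    have h1 : ∑ i, b i * F (Pi.single i 1) g = π (c'.1 g) := by
      simp only [hFsingle, hπ]
      exact (hdep g ((hmemGF g).mp g.2).1 ((hmemGF g).mp g.2).2).symm
    rw [h1, add_comm, hπ, hπ, ← map_add, ← mk_apply_mul_eq τ _ c', ← hπ, hπ0]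
    exact h'

/-- **Selection, independent restrictions** (any `p`; no (H.1)/(H.3) needed): for cocycles `cᵢ`
whose restrictions to `G_F` modulo `(τ − 1)T̄` are `𝔽_p`-linearly independent as functions,
`∃ γ ∈ G_F` with `cᵢ(τγ) ∉ (τ − 1)T̄` for every `i` (Sakamoto's Lemma 5.1, "dimension 4" case:
the joint restriction map is ONTO `𝔽_p^ι`). [cite: Sakamoto2024, Lemma 5.1 (pp. 927–928)] -/
theorem exists_forall_apply_mul_notMem_range_of_restrictions {p : ℕ} [Fact p.Prime] {N : ℕ}
    {τ : Field.absoluteGaloisGroup K} (e : cokerSubOne ρ τ ≃+ ZMod p)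
    {ι : Type*} [Fintype ι] [DecidableEq ι] (c : ι → contOneCocycles ρ.toTopRep)
    (hres : ∀ a : ι → ZMod p,
      (∀ g : Field.absoluteGaloisGroup K, ρ g = 1 → g ∈ rootsOfUnityFixer K N →
        ∑ i, a i * e (QuotientAddGroup.mk ((c i).1 g)) = 0) → a = 0) :
    ∃ γ : Field.absoluteGaloisGroup K, ρ γ = 1 ∧ γ ∈ rootsOfUnityFixer K N ∧
      ∀ i, (c i).1 (τ * γ) ∉ ((ρ τ).toAddMonoidHom - AddMonoidHom.id M).range := by
  classical
  set GF : Subgroup (Field.absoluteGaloisGroup K) := ρ.ker ⊓ rootsOfUnityFixer K N with hGF_def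
  have hmemGF : ∀ g : Field.absoluteGaloisGroup K, g ∈ GF ↔ ρ g = 1 ∧ g ∈ rootsOfUnityFixer K N :=
    fun g => by rw [hGF_def, Subgroup.mem_inf, ContinuousRep.mem_ker]; exact Iff.rfl
  set R : AddSubgroup M := ((ρ τ).toAddMonoidHom - AddMonoidHom.id M).range with hR_def
  let π : M →+ ZMod p := e.toAddMonoidHom.comp (QuotientAddGroup.mk' R)
  have hπ : ∀ m, π m = e (QuotientAddGroup.mk m) := fun m => rfl
  have hπ0 : ∀ m, π m = 0 ↔ m ∈ R := fun m => by
    rw [hπ, e.map_eq_zero_iff, QuotientAddGroup.eq_zero_iff]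
  let E : ι → (↥GF → ZMod p) := fun i g => π ((c i).1 g)
  let F : (ι → ZMod p) →ₗ[ZMod p] (↥GF → ZMod p) := Fintype.linearCombination (ZMod p) E
  have hFapply : ∀ a (g : GF), F a g = ∑ i, a i * π ((c i).1 g) := fun a g => by
    change (Fintype.linearCombination (ZMod p) E a) g = _
    rw [Fintype.linearCombination_apply, Finset.sum_apply]
    simp only [Pi.smul_apply, smul_eq_mul, E]
  have hFsingle : ∀ i (g : GF), F (Pi.single i 1) g = π ((c i).1 g) := fun i g => by
    change (Fintype.linearCombination (ZMod p) E (Pi.single i 1)) g = _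
    rw [Fintype.linearCombination_apply_single, one_smul]
  have hFmul : ∀ a (g h : GF), F a (g * h) = F a g + F a h := by
    intro a g h
    rw [hFapply, hFapply, hFapply, ← Finset.sum_add_distrib]
    refine Finset.sum_congr rfl fun i _ => ?_
    rw [Subgroup.coe_mul, apply_mul_of_apply_eq_one (c i) ((hmemGF g).mp g.2).1, map_add, mul_add]
  have hker : ∀ a, F a = 0 → a = 0 := fun a ha =>
    hres a fun g hg hgμ => by
      have h := congrFun ha ⟨g, (hmemGF g).mpr ⟨hg, hgμ⟩⟩
      rw [hFapply] at h
      exact h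
  obtain ⟨g, hg⟩ := exists_forall_apply_add_ne_zero_of_ker_eq_bot F hFmul hker
    fun i => π ((c i).1 τ)
  refine ⟨g, ((hmemGF g).mp g.2).1, ((hmemGF g).mp g.2).2, fun i hi => ?_⟩
  apply hg i
  rw [hFsingle, add_comm, hπ, hπ, ← map_add, ← mk_apply_mul_eq τ _ (c i), ← hπ, hπ0]
  exact hi

/-! ## Sakamoto's Lemma 5.2, selection half: independent CLASSES plus one non-zero class -/

/-- **THE SELECTION for an independent family plus one class** ([S24] Lemma 5.2's group-theoretic
half in the form Lemma 6.4 uses; `p ≥ 3`).  Let `ρ` be a discrete `Γ_K`-module on `T̄ = M`,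
`τ ∈ Γ_K` with `T̄/(τ − 1)T̄ ≃ ℤ/p`, (H.1) and (H.3) as in T-C55K; let `cᵢ` (`i ∈ ι`) be continuous
crossed homomorphisms whose CLASSES are `𝔽_p`-linearly independent in `H¹(K, T̄)`
(`hind : Σ aᵢ [cᵢ] = 0 ⟹ a = 0`, `ℕ`-multiples of the classes), and `c′` one more with `[c′] ≠ 0`.
Then `∃ γ ∈ G_F = ker ρ ⊓ Gal(K̄/K(μ_N))` with `cᵢ(τγ) ∉ (τ − 1)T̄` for every `i` and
`c′(τγ) ∉ (τ − 1)T̄`.  At four classes (`#ι = 3`) this is exactly "dim_𝔽₃(Σ 𝔽₃ cⱼ) ≥ 3".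
[cite: Sakamoto2024, Lemma 5.2 (p. 928) and Lemma 6.4 (pp. 931–932)]
[cite: MazurRubin2004, Prop. 3.6.1 proof, p. 31] -/
theorem exists_forall_apply_mul_notMem_range_of_linearIndependent {p : ℕ} [Fact p.Prime]
    (hp : 3 ≤ p) {N : ℕ} {τ : Field.absoluteGaloisGroup K} (e : cokerSubOne ρ τ ≃+ ZMod p)
    (hirr : ∀ A : AddSubgroup M,
      (∀ (s : Field.absoluteGaloisGroup K), ∀ m ∈ A, ρ s m ∈ A) → A = ⊥ ∨ A = ⊤)
    (hH3 : ∀ f : contOneCocycles ρ.toTopRep,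
      (∀ u : Field.absoluteGaloisGroup K, ρ u = 1 → u ∈ rootsOfUnityFixer K N → f.1 u = 0) →
        oneCocycleClass ρ.toTopRep f = 0)
    {ι : Type*} [Fintype ι] [DecidableEq ι] (c : ι → contOneCocycles ρ.toTopRep)
    (hind : ∀ a : ι → ZMod p,
      (∑ i, (a i).val • oneCocycleClass ρ.toTopRep (c i)) = 0 → a = 0)
    (c' : contOneCocycles ρ.toTopRep) (hc' : oneCocycleClass ρ.toTopRep c' ≠ 0) :
    ∃ γ : Field.absoluteGaloisGroup K, ρ γ = 1 ∧ γ ∈ rootsOfUnityFixer K N ∧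
      (∀ i, (c i).1 (τ * γ) ∉ ((ρ τ).toAddMonoidHom - AddMonoidHom.id M).range) ∧
      c'.1 (τ * γ) ∉ ((ρ τ).toAddMonoidHom - AddMonoidHom.id M).range := by
  classical
  set R : AddSubgroup M := ((ρ τ).toAddMonoidHom - AddMonoidHom.id M).range with hR_def
  let π : M →+ ZMod p := e.toAddMonoidHom.comp (QuotientAddGroup.mk' R)
  have hπ : ∀ m, π m = e (QuotientAddGroup.mk m) := fun m => rfl
  have hπ0 : ∀ m, π m = 0 ↔ m ∈ R := fun m => by
    rw [hπ, e.map_eq_zero_iff, QuotientAddGroup.eq_zero_iff]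
  haveI : NeZero p := ⟨(Fact.out : p.Prime).ne_zero⟩
  -- independence of CLASSES ⟹ independence of the restrictions to `G_F` modulo `(τ − 1)T̄`
  have hres : ∀ a : ι → ZMod p,
      (∀ g : Field.absoluteGaloisGroup K, ρ g = 1 → g ∈ rootsOfUnityFixer K N →
        ∑ i, a i * e (QuotientAddGroup.mk ((c i).1 g)) = 0) → a = 0 := by
    intro a ha
    refine hind a ?_
    rw [← oneCocycleClass_sum_nsmul c fun i => (a i).val]
    refine oneCocycleClass_eq_zero_of_forall_apply_mem_range e hirr hH3 _ fun g hg hgμ => ?_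
    rw [← hπ0, map_sum_val_nsmul_apply π c a g]
    exact ha g hg hgμ
  by_cases hD : ∃ b : ι → ZMod p, ∀ g : Field.absoluteGaloisGroup K, ρ g = 1 →
      g ∈ rootsOfUnityFixer K N →
        (e (QuotientAddGroup.mk (c'.1 g)) : ZMod p) = ∑ i, b i * e (QuotientAddGroup.mk ((c i).1 g))
  · -- dependent case: `c̄′ = Σ bᵢ c̄ᵢ` on `G_F`, with `b ≠ 0` since `[c′] ≠ 0`
    obtain ⟨b, hb⟩ := hD
    have hb0 : b ≠ 0 := by
      rintro rfl
      refine hc' (oneCocycleClass_eq_zero_of_forall_apply_mem_range e hirr hH3 c' fun g hg hgμ => ?_)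
      rw [← hπ0, hπ, hb g hg hgμ]
      simp only [Pi.zero_apply, zero_mul, Finset.sum_const_zero]
    exact exists_forall_apply_mul_notMem_range_of_restrictions_extra hp e hirr hH3 c hres c' hb0 hb
  · -- independent case: the family on `Option ι` (`none ↦ c′`) has independent restrictions
    push Not at hD
    let d : Option ι → contOneCocycles ρ.toTopRep := fun o => o.elim c' c
    have hres' : ∀ a : Option ι → ZMod p,
        (∀ g : Field.absoluteGaloisGroup K, ρ g = 1 → g ∈ rootsOfUnityFixer K N →
          ∑ o, a o * e (QuotientAddGroup.mk ((d o).1 g)) = 0) → a = 0 := by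
      intro a ha
      have hsplit : ∀ g : Field.absoluteGaloisGroup K,
          ∑ o, a o * e (QuotientAddGroup.mk ((d o).1 g)) =
            a none * e (QuotientAddGroup.mk (c'.1 g)) +
              ∑ i, a (some i) * e (QuotientAddGroup.mk ((c i).1 g)) := fun g => by
        rw [Fintype.sum_option]
        rfl
      -- the coefficient of `c′` vanishes, else `c̄′` is a combination of the `c̄ᵢ`
      have hnone : a none = 0 := by
        by_contra hne
        obtain ⟨g, hg, hgμ, hneq⟩ := hD (fun i => -(a none)⁻¹ * a (some i))
        apply hneq
        have h := ha g hg hgμ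
        rw [hsplit] at h
        have h' : e (QuotientAddGroup.mk (c'.1 g)) =
            -(a none)⁻¹ * ∑ i, a (some i) * e (QuotientAddGroup.mk ((c i).1 g)) := by
          have := congrArg (fun x => (a none)⁻¹ * x) h
          simp only [mul_add, ← mul_assoc, inv_mul_cancel₀ hne, one_mul, mul_zero] at this
          linear_combination this
        rw [h', Finset.mul_sum]
        exact Finset.sum_congr rfl fun i _ => by ring
      have hsome : (fun i => a (some i)) = 0 := by
        refine hres _ fun g hg hgμ => ?_
        have h := ha g hg hgμ
        rw [hsplit, hnone, zero_mul, zero_add] at h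
        exact h
      funext o
      cases o with
      | none => exact hnone
      | some i => exact congrFun hsome i
    obtain ⟨γ, hγρ, hγμ, hγ⟩ :=
      exists_forall_apply_mul_notMem_range_of_restrictions (N := N) e d hres'
    exact ⟨γ, hγρ, hγμ, fun i => hγ (some i), hγ none⟩

end Summit.BirchSwinnertonDyer.Rank1Residual.GaloisImage.PrimeChoice

end
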